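import Literature.MathematicalPhysics.QuantumFieldTheory.Balaban1983to89.B11Eq115Space
import Literature.MathematicalPhysics.QuantumFieldTheory.Balaban1983to89.B9Eq33CovDerivVector

/-!
# `Balaban1983to89.B11Eq111FrakG` — T. Bałaban, *The variational problem and background fields in renormalization group
# method for lattice gauge theories*, Commun. Math. Phys. **102** (1985) 277–309 [Balaban1985Variational], (110)–(111) p. 294
# with [5] = *Propagators for lattice gauge theories in a background field*, Commun. Math. Phys. **99** (1985) 389–434
# [Balaban1985BackgroundPropagators], (3.147), (3.148), (3.153) pp. 425–426: THE OPERATOR `𝔊 = G₁𝔓*` of equation (111)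
# AS AN OBJECT — a continuous linear map from the currents `|·|_{(−3)}` to the space (115) — built from the Sect. D data
# `G₁, Q, Q*, (QG₁Q*)⁻¹, D, R, D*` as linear maps, with its printed RANGE PROPERTY `Q𝔊 = 0`, `RD*𝔊 = 0` PROVED from the
# displayed operator identities the print invokes ((3.124) and `RD*G₁DR = R`)

statement-level skeleton of published theorems with citation tags; proofs where landed; nothing here is a claim
about the Yang–Mills mass gap

PDF held: `paper:balaban1985-cmp102-variational-background` (journal page = PDF page + 276), pp. 294–295 (PDF 18–19), and
`paper:balaban1985-cmp99-background-propagators` (journal page = PDF page + 388), pp. 425–426 (PDF 37–38), read from the held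
text by this seat (`lit read`, 2026-08-21).

THE PRINT (verbatim).  [Balaban1985Variational] p. 294: *«We denote by G₁ an inverse operator to the operator Δ₁ + DRD* + aQ*Q.
… In [5] we have proved that the operator G₁𝔓* is equal to the operator 𝔊 defined by (3.148) and satisfying the equalities
Q𝔊 = 0, RD*𝔊 = 0. Thus any solution of (110) satisfies automatically Eq. (108), (109). Let us rewrite this equation using the
operator 𝔊, A₁ + 𝔊J + 𝔊((δ/δA′)V)(A₁ + H₁B) = 0. (111)»*; p. 295: *«A solution of Eq. (111) is a fixed point of the
transformation A₁ → −𝔊J − 𝔊((δ/δA′)V)(A₁ + H₁B). (116) … By Theorem 3.13 of [5] the norm max{|·|_{(−1)}, |∇·|_{(−2)}} of the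
transformation can be estimated by B₀|J|_{(−3)} + B₀|((δ/δA′)V)(A₁ + H₁B)|_{(−3)} (117)»*.  [Balaban1985BackgroundPropagators]
p. 425: *«𝔓 = I − G₁Q*(QG₁Q*)⁻¹Q − G₁DRD*. (3.147) It is easy to verify explicitly properties of the operator 𝔓, i.e. Q𝔓 = 0,
RD*𝔓 = 0, 𝔓² = 𝔓 … Thus 𝔓 is an orthogonal projection in the Hilbert space onto a subspace contained in {A : QA = 0, RD*A = 0}.
If we take A₀ from the last subspace, then 𝔓A₀ = A₀ by (3.147), hence the range of 𝔓 is equal to it. Verifying the above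
properties we need to know only the identities (3.124) and RD*G₁DR = R.»*; (3.148) defines 𝔊 as the covariance of a Gaussian
integral; p. 426: *«𝔊 = G₁ − G₁DRD*G₁ − G₁Q*(QG₁Q*)⁻¹QG₁ = G₁𝔓* = 𝔓G₁. (3.153) … Especially for 𝔊 we have, assuming (3.132)
Theorem 3.13. …»*.

WHY THIS FILE (cell context).  The contraction scheme of Sects. E–G is kernel-checked over ABSTRACT spaces with `𝒢 : 𝒵 →L[ℂ] 𝒴`
a datum (`B11Prop6Scheme.mapT`, `B11Eq174Chart.Regime.norm_G : ‖𝒢 f‖ ≤ B₀‖f‖`), and since `B11Eq115Space` (letter (L1)) over the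
CONCRETE carriers `𝒴 := Space115 L η lev₀ lev₁ ∇`, `𝒵 := NegSize L η lev₀ 3 V`.  The tree's `B9` types 𝔓, 𝔓*, (3.150), (3.153) as
RING identities (`B9.frakP`, `frakPstar`, `q_mul_frakP`, `rds_mul_frakP`, `frakP_idem`, `frakG_3153` — one ring, square letters),
`B9Eq3147` as real MATRIX identities, and r08's `B11Eq108Reduction` proves (105)–(111) with 𝔓 HYPOTHESIS-STYLE (any `P` with range in
the constraint space, `M`-symmetric) over REAL inner-product spaces — its `frakG_mem`/`frakG_eq_proj_comp` are the abstract twins of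
§1's `apply_Q_frakGLin`/`apply_RDstar_frakGLin`/`frakGLin_eq_frakPLin_comp`, which take 𝔓 as the explicit FORMULA (3.147) over
rectangular `ℂ`-linear data, no inner product; and the NE9 owner's `B9Eq3147ProjectionOps` (p287482) types 𝔓/𝔓*/𝔊 at the HILBERT
level (real `InnerProductSpace`, `G₁ := B11Eq110GreenInverse.G1` CONSTRUCTED from positivity; `frakGCLM : E →L[ℝ] E`) — §1 below is its
`𝕜`-generic DATA-level twin, which the COMPLEX sup-norm carriers of (115) need until the ℝ/L² → ℂ/(115) transfer the owner names as the
remaining step is written.  THIS FILE supplies letter (L2) of the NE9 letter map (lit-balaban `INTERFACES.md` §3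
NEED-3; pub-balaban `INTERFACE REQUEST NE9 (L2)`, HOME/INBOX.md l.11396): `𝔊` as the continuous linear map
`NegSize L η lev₀ 3 V →L[ℂ] Space115 L η lev₀ lev₁ ∇` the scheme consumes, over the rectangular letters of `B11Eq129Minimizer` /
`B11Eq101Translation` (`G₁`, `Q`, `Qadj` = Q*, `Kinv` = (QG₁Q*)⁻¹, `D`, `R`, `Dstar` = D* — the data from which (129)/(103)
`H₁B = G₁Q*(QG₁Q*)⁻¹b`, `B11Eq129Minimizer.hOp`, is built), with the one property the scheme consumes beyond the norm: RANGE 𝔊 ⊆ the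
constraint subspace (102)/(109) (the hypothesis `h𝒢S` of `B11Prop6Scheme.solution_mem_submodule`), PROVED from the displayed identities.

WHAT IS DEFINED AND PROVED (sorry-free; no `Prop` placeholder; no inequality of the papers).
* §1 (any commutative ring `𝕜`; modules `E` ∋ A, `F` ∋ QA, `S` ∋ D*A): `frakPLin` = 𝔓 (3.147), `frakPstarLin` = 𝔓*, **`frakGLin :=
  G₁ ∘ 𝔓*`** = 𝔊 ((3.153)/(110)–(111)); `frakGLin_eq_frakPLin_comp` (G₁𝔓* = 𝔓G₁, an identity of the formulas); from the DISPLAYED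
  relations `hK : QG₁Q*·Kinv = 1`, (3.124) `h124 : QG₁DR = 0`, `h124' : RD*G₁Q* = 0`, `hRDR : RD*G₁DR = R`: `apply_Q_frakPLin`,
  `apply_RDstar_frakPLin`, `frakPLin_eq_self`, `frakPLin_idem`, **`mem_range_frakPLin_iff`** (range 𝔓 = (102) exactly, p. 425),
  **`apply_Q_frakGLin`, `apply_RDstar_frakGLin`** (*«Q𝔊 = 0, RD*𝔊 = 0»*), `frakPLin_frakGLin`.
* §2 (carriers of `B11Eq115Space`; finite index types, finite-dimensional complex fibre): `jetLinearEquiv`, `toCLM115` (a linear map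
  of the functions read as a CONTINUOUS linear map `|·|_{(−3)} → (115)` — finite lattice), **`frakG lev₁ ∇ G₁ Q Qadj Kinv D R Dstar`**
  = 𝔊 AS THE SCHEME'S `𝒢`, `frakG_apply`; `constraint102` ((102)/(109) as a `Submodule ℂ (Space115 …)`), `mem_constraint102_iff`,
  `isClosed_constraint102`; **`frakG_mem_constraint102`** (the bound (117) is NOT derived: its uniform `B₀` = Thm 3.13 [5] stays
  `Regime.norm_G`/`B9.Thm313Printed`); **`solA115_mem_constraint102`** — under a `Regime`
  with `𝒢 := frakG …` and a (102)-preserving linear term, `solA115` lies in (102) (*«any solution of (110) satisfies automatically Eq.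
  (108), (109)»*, `B11Prop6Scheme.solution_mem_submodule` AT THE OBJECT).
* §3 the REFERENCE SPELLING **`nabla115 η U₀ := covGrad ((η : ℂ)⁻¹) (adTransport U₀)`** of the ∇ of (115) ([5] (3.3); ONE term for
  (L2)/(L3)/(L4)/(L6)/(L7)/(L8) — the space (115) is indexed by it), `nabla115_apply`; **`frakGAt lev₁ U₀ …`** `: NegSize L η lev₀ 3 𝔸
  →L[ℂ] Space115 L η lev₀ lev₁ (nabla115 η U₀)` = THE REQUESTED LETTER, `frakGAt_eq` (the request's spelling, `rfl`),
  `frakGAt_mem_constraint102`.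

MODEL / DECLARED READINGS.  (M1) DATA FIRST: `G₁`, `Q`, `Q*`, `(QG₁Q*)⁻¹`, `D`, `R`, `D*` are PARAMETERS — «G₁ an inverse operator to
Δ₁ + DRD* + aQ*Q» is CONSTRUCTED (from [5] Thm 3.11's positivity, displayed) in the NE9 owner's `B11Eq110GreenInverse` (p287198,
`green`, `laplaceA_G1`, `hK_holds`, Hilbert level), whose `G₁`/`(QG₁Q*)⁻¹` read as linear maps of the functions are this file's data
(`hK` then holds by `hK_holds`); the lattice operators ([5] (3.126), (3.129), `Q_j`, the Landau `R`) are NOT constructed, and `hK`, `h124`,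
`h124'`, `hRDR` are DISPLAYED hypotheses (print: *«we need to know only the identities (3.124) and RD*G₁DR = R»*).  (M2) RECTANGULAR
LETTERS (`Q : E → F`, `D : S → E`, …); `B9.frakP`'s ring letters are the square case — the identities are re-derived for linear maps in
three lines each (ring twins cited).  (M3) 𝔊 := `G₁𝔓*` ((3.153), (110)–(111)), not the Gaussian covariance (3.148); their
identification is [5]'s (3.149)–(3.153), not re-derived.  (M4) CONTINUITY is the finite-dimensional automatic one; the QUANTITATIVE
(117) `‖𝔊f‖ ≤ B₀|f|_{(−3)}` uniform in the lattice is Thm 3.13 of [5] and stays displayed.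
HONEST SCOPE.  [folklore] linear algebra around ONE printed object; no estimate of either paper is proved; NOT summit progress (cell
pub-balaban: NE9 NOT PRINTED / NOT PROVED; spine PROVED 0/9).  Filed by the pub-balaban seat `b2b-balaban-t4-ne9-formalise-leaf-05`
(gen 62) on the NE9 owner's INTERFACE REQUEST NE9 (L2) — a NEW file; no lit-balaban file is modified.  Net new unproved facts: 0.
-/

noncomputable section

namespace Literature.MathematicalPhysics.QuantumFieldTheory.Balaban1983to89.B11Eq111FrakG

/-! ## §1 [5] (3.147), (3.153): `𝔓`, `𝔓*`, `𝔊 = G₁𝔓*` as linear maps of the Sect. D data, and their printed identities -/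

section Algebra

variable {𝕜 : Type*} [CommRing 𝕜] {E F S : Type*} [AddCommGroup E] [Module 𝕜 E] [AddCommGroup F] [Module 𝕜 F]
  [AddCommGroup S] [Module 𝕜 S]
variable (G₁ : E →ₗ[𝕜] E) (Q : E →ₗ[𝕜] F) (Qadj : F →ₗ[𝕜] E) (Kinv : F →ₗ[𝕜] F) (D : S →ₗ[𝕜] E) (R : S →ₗ[𝕜] S)
  (Dstar : E →ₗ[𝕜] S)

/-- **`𝔓 = I − G₁Q*(QG₁Q*)⁻¹Q − G₁DRD*` (3.147)** as a linear map of the data (`Qadj` = Q*, `Kinv` = (QG₁Q*)⁻¹, `Dstar` = D*);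
ring twin `B9.frakP`. [cite: Balaban1985BackgroundPropagators, (3.147) p.425] -/
def frakPLin : E →ₗ[𝕜] E :=
  LinearMap.id - G₁ ∘ₗ Qadj ∘ₗ Kinv ∘ₗ Q - G₁ ∘ₗ D ∘ₗ R ∘ₗ Dstar

/-- **`𝔓* = I − Q*(QG₁Q*)⁻¹QG₁ − DRD*G₁`**, the formal `G₁⁻¹`-adjoint of 𝔓 appearing in (3.153); ring twin `B9.frakPstar`.
[cite: Balaban1985BackgroundPropagators, (3.153) p.426] -/
def frakPstarLin : E →ₗ[𝕜] E :=
  LinearMap.id - Qadj ∘ₗ Kinv ∘ₗ Q ∘ₗ G₁ - D ∘ₗ R ∘ₗ Dstar ∘ₗ G₁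

/-- **`𝔊 = G₁𝔓*` (3.153)** — [Balaban1985Variational] p. 294 *«the operator G₁𝔓* is equal to the operator 𝔊»*, the operator of
equation (111) — as a linear map of the data. [cite: Balaban1985Variational, (110)–(111) p.294] -/
def frakGLin : E →ₗ[𝕜] E :=
  G₁ ∘ₗ frakPstarLin G₁ Q Qadj Kinv D R Dstar

/-- Unfolding (3.147): `𝔓x = x − G₁Q*(QG₁Q*)⁻¹Qx − G₁DRD*x`. [cite: Balaban1985BackgroundPropagators, (3.147) p.425] -/
@[simp] theorem frakPLin_apply (x : E) :
    frakPLin G₁ Q Qadj Kinv D R Dstar x = x - G₁ (Qadj (Kinv (Q x))) - G₁ (D (R (Dstar x))) := rfl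

/-- Unfolding 𝔓*: `𝔓*x = x − Q*(QG₁Q*)⁻¹QG₁x − DRD*G₁x`. [cite: Balaban1985BackgroundPropagators, (3.153) p.426] -/
@[simp] theorem frakPstarLin_apply (x : E) :
    frakPstarLin G₁ Q Qadj Kinv D R Dstar x = x - Qadj (Kinv (Q (G₁ x))) - D (R (Dstar (G₁ x))) := rfl

/-- Unfolding (3.153): `𝔊x = G₁x − G₁Q*(QG₁Q*)⁻¹QG₁x − G₁DRD*G₁x`. [cite: Balaban1985BackgroundPropagators, (3.153) p.426] -/
theorem frakGLin_apply (x : E) :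
    frakGLin G₁ Q Qadj Kinv D R Dstar x = G₁ x - G₁ (Qadj (Kinv (Q (G₁ x)))) - G₁ (D (R (Dstar (G₁ x)))) := by
  simp only [frakGLin, LinearMap.comp_apply, frakPstarLin_apply, map_sub]

/-- **(3.153) `G₁𝔓* = 𝔓G₁`** — an identity of the two formulas (no data relation needed); ring twin: the second member of
`B9.frakG_3153`. [cite: Balaban1985BackgroundPropagators, (3.153) p.426] -/
theorem frakGLin_eq_frakPLin_comp :
    frakGLin G₁ Q Qadj Kinv D R Dstar = frakPLin G₁ Q Qadj Kinv D R Dstar ∘ₗ G₁ := by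
  ext x
  simp only [frakGLin_apply, LinearMap.comp_apply, frakPLin_apply]

/-- `𝔊x = 𝔓(G₁x)`. [cite: Balaban1985BackgroundPropagators, (3.153) p.426] -/
theorem frakGLin_apply_eq_frakPLin (x : E) :
    frakGLin G₁ Q Qadj Kinv D R Dstar x = frakPLin G₁ Q Qadj Kinv D R Dstar (G₁ x) := by rw [frakGLin_eq_frakPLin_comp]; rfl

variable {G₁ Q Qadj Kinv D R Dstar}

/-- **p. 425 «Q𝔓 = 0»** from `QG₁Q*·(QG₁Q*)⁻¹ = 1` (`hK`, the letter of `B11Eq129Minimizer.constraint_hOp`) and (3.124) `QG₁DR = 0`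
(`h124`); ring twin `B9.q_mul_frakP`. [cite: Balaban1985BackgroundPropagators, p.425] -/
theorem apply_Q_frakPLin (hK : ∀ y : F, Q (G₁ (Qadj (Kinv y))) = y) (h124 : ∀ s : S, Q (G₁ (D (R s))) = 0) (x : E) :
    Q (frakPLin G₁ Q Qadj Kinv D R Dstar x) = 0 := by
  simp only [frakPLin_apply, map_sub, hK, h124, sub_self]

/-- **p. 425 «RD*𝔓 = 0»** from (3.124) `RD*G₁Q* = 0` (`h124'`) and `RD*G₁DR = R` (`hRDR`); ring twin `B9.rds_mul_frakP`.
[cite: Balaban1985BackgroundPropagators, p.425] -/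
theorem apply_RDstar_frakPLin (h124' : ∀ y : F, R (Dstar (G₁ (Qadj y))) = 0)
    (hRDR : ∀ s : S, R (Dstar (G₁ (D (R s)))) = R s) (x : E) :
    R (Dstar (frakPLin G₁ Q Qadj Kinv D R Dstar x)) = 0 := by
  simp only [frakPLin_apply, map_sub, h124', hRDR, sub_zero, sub_self]

/-- **p. 425 «If we take A₀ from the last subspace, then 𝔓A₀ = A₀ by (3.147)»**: on `{QA = 0, RD*A = 0}` the operator 𝔓 is the
identity. [cite: Balaban1985BackgroundPropagators, p.425] -/
theorem frakPLin_eq_self {x : E} (hQ : Q x = 0) (hR : R (Dstar x) = 0) : frakPLin G₁ Q Qadj Kinv D R Dstar x = x := by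
  simp only [frakPLin_apply, hQ, hR, map_zero, sub_zero]

/-- **p. 425 «𝔓² = 𝔓»** from Q𝔓 = 0 and RD*𝔓 = 0; ring twin `B9.frakP_idem`. [cite: Balaban1985BackgroundPropagators, p.425] -/
theorem frakPLin_idem (hK : ∀ y : F, Q (G₁ (Qadj (Kinv y))) = y) (h124 : ∀ s : S, Q (G₁ (D (R s))) = 0)
    (h124' : ∀ y : F, R (Dstar (G₁ (Qadj y))) = 0) (hRDR : ∀ s : S, R (Dstar (G₁ (D (R s)))) = R s) (x : E) :
    frakPLin G₁ Q Qadj Kinv D R Dstar (frakPLin G₁ Q Qadj Kinv D R Dstar x) = frakPLin G₁ Q Qadj Kinv D R Dstar x :=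
  frakPLin_eq_self (apply_Q_frakPLin hK h124 x) (apply_RDstar_frakPLin h124' hRDR x)

/-- **p. 425: the range of 𝔓 IS the subspace `{QA = 0, RD*A = 0}`** (⊆ by Q𝔓 = 0, RD*𝔓 = 0; ⊇ by 𝔓A₀ = A₀).
[cite: Balaban1985BackgroundPropagators, p.425] -/
theorem mem_range_frakPLin_iff (hK : ∀ y : F, Q (G₁ (Qadj (Kinv y))) = y) (h124 : ∀ s : S, Q (G₁ (D (R s))) = 0)
    (h124' : ∀ y : F, R (Dstar (G₁ (Qadj y))) = 0) (hRDR : ∀ s : S, R (Dstar (G₁ (D (R s)))) = R s) (x : E) :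
    x ∈ LinearMap.range (frakPLin G₁ Q Qadj Kinv D R Dstar) ↔ Q x = 0 ∧ R (Dstar x) = 0 := by
  constructor
  · rintro ⟨y, rfl⟩
    exact ⟨apply_Q_frakPLin hK h124 y, apply_RDstar_frakPLin h124' hRDR y⟩
  · rintro ⟨hQ, hR⟩
    exact ⟨x, frakPLin_eq_self hQ hR⟩

/-- **[Balaban1985Variational] p. 294 «𝔊 … satisfying the equalities Q𝔊 = 0»** (= Q𝔓G₁ = 0).
[cite: Balaban1985Variational, (110)–(111) p.294] -/
theorem apply_Q_frakGLin (hK : ∀ y : F, Q (G₁ (Qadj (Kinv y))) = y) (h124 : ∀ s : S, Q (G₁ (D (R s))) = 0) (x : E) :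
    Q (frakGLin G₁ Q Qadj Kinv D R Dstar x) = 0 := by
  rw [frakGLin_apply_eq_frakPLin]; exact apply_Q_frakPLin hK h124 _

/-- **[Balaban1985Variational] p. 294 «… RD*𝔊 = 0»** (= RD*𝔓G₁ = 0). [cite: Balaban1985Variational, (110)–(111) p.294] -/
theorem apply_RDstar_frakGLin (h124' : ∀ y : F, R (Dstar (G₁ (Qadj y))) = 0)
    (hRDR : ∀ s : S, R (Dstar (G₁ (D (R s)))) = R s) (x : E) :
    R (Dstar (frakGLin G₁ Q Qadj Kinv D R Dstar x)) = 0 := by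
  rw [frakGLin_apply_eq_frakPLin]; exact apply_RDstar_frakPLin h124' hRDR _

/-- Hence `𝔓𝔊 = 𝔊`: 𝔊 takes values in the range of the projection. [cite: Balaban1985BackgroundPropagators, (3.153) p.426] -/
theorem frakPLin_frakGLin (hK : ∀ y : F, Q (G₁ (Qadj (Kinv y))) = y) (h124 : ∀ s : S, Q (G₁ (D (R s))) = 0)
    (h124' : ∀ y : F, R (Dstar (G₁ (Qadj y))) = 0) (hRDR : ∀ s : S, R (Dstar (G₁ (D (R s)))) = R s) (x : E) :
    frakPLin G₁ Q Qadj Kinv D R Dstar (frakGLin G₁ Q Qadj Kinv D R Dstar x) = frakGLin G₁ Q Qadj Kinv D R Dstar x :=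
  frakPLin_eq_self (apply_Q_frakGLin hK h124 x) (apply_RDstar_frakGLin h124' hRDR x)

end Algebra

/-! ## §2 `𝔊` on the carriers of (115): the scheme's `𝒢 : |·|_{(−3)} →L[ℂ] (115)` and its range in the subspace (102) -/

section Carriers

open B11Eq115Space

variable {ι κ : Type*} {V : Type*} [NormedAddCommGroup V] [NormedSpace ℂ V] {L η : ℝ} {lev₀ : ι → ℕ}
  {F S : Type*} [AddCommGroup F] [Module ℂ F] [AddCommGroup S] [Module ℂ S]

/-- The space (115) read as plain functions `ι → V`, linearly (the identification `JetSup.equiv` with its additivity and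
homogeneity). [folklore] -/
def jetLinearEquiv (L η : ℝ) (lev₀ : ι → ℕ) (lev₁ : κ → ℕ) (Dc : (ι → V) →ₗ[ℂ] (κ → V)) :
    Space115 L η lev₀ lev₁ Dc ≃ₗ[ℂ] (ι → V) :=
  { JetSup.equiv (levWeight L η lev₀ 1) (levWeight L η lev₁ 2) Dc with
    map_add' := fun _ _ => rfl
    map_smul' := fun _ _ => rfl }

/-- The linear reading of the space (115) is the identification with functions. [cite: Balaban1985Variational, (115) p.294] -/
@[simp] theorem jetLinearEquiv_apply (lev₁ : κ → ℕ) (Dc : (ι → V) →ₗ[ℂ] (κ → V)) (A : Space115 L η lev₀ lev₁ Dc) :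
    jetLinearEquiv L η lev₀ lev₁ Dc A = JetSup.equiv _ _ Dc A := rfl

/-- **The constraint subspace (102)/(109) `{A₁ : QA₁ = 0, RD*A₁ = 0}`** of the space (115), as a complex submodule.
[cite: Balaban1985Variational, (102) p.293, (109) p.294] -/
def constraint102 (lev₁ : κ → ℕ) (Dc : (ι → V) →ₗ[ℂ] (κ → V)) (Q : (ι → V) →ₗ[ℂ] F) (R : S →ₗ[ℂ] S)
    (Dstar : (ι → V) →ₗ[ℂ] S) : Submodule ℂ (Space115 L η lev₀ lev₁ Dc) :=
  (LinearMap.ker Q ⊓ LinearMap.ker (R ∘ₗ Dstar)).comap (jetLinearEquiv L η lev₀ lev₁ Dc).toLinearMap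

/-- Membership in (102): `QA₁ = 0` and `RD*A₁ = 0` for the underlying function. [cite: Balaban1985Variational, (102) p.293] -/
theorem mem_constraint102_iff (lev₁ : κ → ℕ) (Dc : (ι → V) →ₗ[ℂ] (κ → V)) (Q : (ι → V) →ₗ[ℂ] F) (R : S →ₗ[ℂ] S)
    (Dstar : (ι → V) →ₗ[ℂ] S) (A : Space115 L η lev₀ lev₁ Dc) :
    A ∈ constraint102 lev₁ Dc Q R Dstar ↔ Q (JetSup.equiv _ _ Dc A) = 0 ∧ R (Dstar (JetSup.equiv _ _ Dc A)) = 0 := by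
  simp only [constraint102, Submodule.mem_comap, Submodule.mem_inf, LinearMap.mem_ker, LinearEquiv.coe_coe,
    jetLinearEquiv_apply, LinearMap.comp_apply]

variable [Fintype ι] [Fintype κ] [FiniteDimensional ℂ V] [Fact (0 < L)] [Fact (0 < η)]

/-- A linear map of the functions `ι → V` READ AS A CONTINUOUS LINEAR MAP from the currents `|·|_{(−3)}` to the space (115) on the
same points — continuity is automatic on the finite lattice (finite index, finite-dimensional fibre). [folklore] -/
def toCLM115 (lev₁ : κ → ℕ) (Dc : (ι → V) →ₗ[ℂ] (κ → V)) (T : (ι → V) →ₗ[ℂ] (ι → V)) :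
    NegSize L η lev₀ 3 V →L[ℂ] Space115 L η lev₀ lev₁ Dc :=
  LinearMap.toContinuousLinearMap
    ((jetLinearEquiv L η lev₀ lev₁ Dc).symm.toLinearMap ∘ₗ T ∘ₗ
      (NegSup.linearEquiv ℂ (levWeight L η lev₀ 3) : NegSize L η lev₀ 3 V ≃ₗ[ℂ] (ι → V)).toLinearMap)

/-- Unfolding: the configuration underlying `toCLM115 T f` is `T` applied to the current underlying `f` (a «transformation» from
`|·|_{(−3)}` to the norm of (115), (117)). [cite: Balaban1985Variational, (117) p.295] -/
@[simp] theorem toCLM115_apply (lev₁ : κ → ℕ) (Dc : (ι → V) →ₗ[ℂ] (κ → V)) (T : (ι → V) →ₗ[ℂ] (ι → V))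
    (f : NegSize L η lev₀ 3 V) :
    JetSup.equiv _ _ Dc (toCLM115 (L := L) (η := η) (lev₀ := lev₀) lev₁ Dc T f) = T (NegSup.equiv _ V f) := rfl

variable (lev₁ : κ → ℕ) (Dc : (ι → V) →ₗ[ℂ] (κ → V))
variable (G₁ : (ι → V) →ₗ[ℂ] (ι → V)) (Q : (ι → V) →ₗ[ℂ] F) (Qadj : F →ₗ[ℂ] (ι → V)) (Kinv : F →ₗ[ℂ] F)
  (D : S →ₗ[ℂ] (ι → V)) (R : S →ₗ[ℂ] S) (Dstar : (ι → V) →ₗ[ℂ] S)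

/-- **THE OBJECT `𝔊 = G₁𝔓*` OF (111)/(116) AS THE SCHEME'S `𝒢 : NegSize L η lev₀ 3 V →L[ℂ] Space115 L η lev₀ lev₁ ∇`** — currents
`J`, `((δ/δA′)V)(·)` in `|·|_{(−3)}` to configurations in the space (115) (*«the norm max{|·|_{(−1)}, |∇·|_{(−2)}} of the
transformation»*, (117)), from the Sect. D data read on the functions `ι → V` (`ι` = the bonds carrying `A₁`).  Plugs into
`B11Eq115Space.solA115`/`chartHB115` and `B11Eq174Chart.Regime` as `𝒢`. [cite: Balaban1985Variational, (111) p.294, (116)–(117) p.295] -/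
def frakG : NegSize L η lev₀ 3 V →L[ℂ] Space115 L η lev₀ lev₁ Dc :=
  toCLM115 lev₁ Dc (frakGLin G₁ Q Qadj Kinv D R Dstar)

/-- Unfolding: the configuration `𝔊f` is the function `G₁𝔓*f`. [cite: Balaban1985Variational, (111) p.294] -/
@[simp] theorem frakG_apply (f : NegSize L η lev₀ 3 V) :
    JetSup.equiv _ _ Dc (frakG lev₁ Dc G₁ Q Qadj Kinv D R Dstar f) =
      frakGLin G₁ Q Qadj Kinv D R Dstar (NegSup.equiv _ V f) := rfl

/-- The subspace (102) is CLOSED in the space (115) (finite lattice: finite-dimensional). [cite: Balaban1985Variational, (102) p.293] -/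
theorem isClosed_constraint102 :
    IsClosed (SetLike.coe (constraint102 (L := L) (η := η) (lev₀ := lev₀) lev₁ Dc Q R Dstar)) :=
  Submodule.closed_of_finiteDimensional _

variable {G₁ Q Qadj Kinv D R Dstar}

/-- **«𝔊 … satisfying the equalities Q𝔊 = 0, RD*𝔊 = 0» AT THE OBJECT: the range of `frakG` lies in the subspace (102)** — the
hypothesis `h𝒢S` of `B11Prop6Scheme.solution_mem_submodule`, from the displayed data relations `hK`, (3.124) `h124`/`h124'`,
`hRDR`. [cite: Balaban1985Variational, (110)–(111) p.294] -/
theorem frakG_mem_constraint102 (hK : ∀ y : F, Q (G₁ (Qadj (Kinv y))) = y) (h124 : ∀ s : S, Q (G₁ (D (R s))) = 0)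
    (h124' : ∀ y : F, R (Dstar (G₁ (Qadj y))) = 0) (hRDR : ∀ s : S, R (Dstar (G₁ (D (R s)))) = R s)
    (f : NegSize L η lev₀ 3 V) :
    frakG lev₁ Dc G₁ Q Qadj Kinv D R Dstar f ∈ constraint102 lev₁ Dc Q R Dstar := by
  rw [mem_constraint102_iff, frakG_apply]
  exact ⟨apply_Q_frakGLin hK h124 _, apply_RDstar_frakGLin h124' hRDR _⟩

/-- **«Thus any solution of (110) satisfies automatically Eq. (108), (109)» AT THE OBJECT**: under a regime of the scheme on the
concrete carriers with `𝒢 := frakG …` (the displayed (117)-bound `B₀`, the quadratic map `W = (δ/δA′)V`, an optional linear term `Λ`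
preserving (102)) and the displayed data relations, the solution `solA115` of (116)/(175) for data `|J|_{(−3)} ≤ j`, `‖𝔄‖ < a` lies
in the constraint subspace (102) — `B11Prop6Scheme.solution_mem_submodule` with `h𝒢S := frakG_mem_constraint102`.
[cite: Balaban1985Variational, (108)–(111) p.294, Prop. 6 p.295] -/
theorem solA115_mem_constraint102 {Λ : Space115 L η lev₀ lev₁ Dc →L[ℂ] Space115 L η lev₀ lev₁ Dc}
    {W : Space115 L η lev₀ lev₁ Dc → NegSize L η lev₀ 3 V} {B₀ θ C₄ a₃ j a ε₄ : ℝ}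
    (Rg : B11Eq174Chart.Regime (frakG lev₁ Dc G₁ Q Qadj Kinv D R Dstar) Λ W B₀ θ C₄ a₃ j a ε₄)
    (hK : ∀ y : F, Q (G₁ (Qadj (Kinv y))) = y) (h124 : ∀ s : S, Q (G₁ (D (R s))) = 0)
    (h124' : ∀ y : F, R (Dstar (G₁ (Qadj y))) = 0) (hRDR : ∀ s : S, R (Dstar (G₁ (D (R s)))) = R s)
    (hΛ : ∀ Y, Λ Y ∈ constraint102 lev₁ Dc Q R Dstar) {J : NegSize L η lev₀ 3 V} (hJ : ‖J‖ ≤ j)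
    {𝔄 : Space115 L η lev₀ lev₁ Dc} (h𝔄 : ‖𝔄‖ < a) :
    solA115 (frakG lev₁ Dc G₁ Q Qadj Kinv D R Dstar) Λ W J ε₄ 𝔄 ∈ constraint102 lev₁ Dc Q R Dstar := by
  obtain ⟨hle, hfix⟩ := Rg.solA_mem hJ h𝔄
  exact B11Prop6Scheme.solution_mem_submodule Rg.norm_G Rg.norm_L Rg.quad Rg.B₀_nonneg Rg.C₄_nonneg Rg.θ_nonneg hJ h𝔄
    Rg.ε₄_nonneg Rg.dom Rg.self Rg.contr (constraint102 lev₁ Dc Q R Dstar) (isClosed_constraint102 lev₁ Dc Q R Dstar)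
    (frakG_mem_constraint102 lev₁ Dc hK h124 h124' hRDR) hΛ hle hfix

end Carriers

/-! ## §3 The requested letter: `𝔊` at the covariant derivative `∇ = ∇^{U₀}` of [5] (3.3) on the periodic lattice -/

section Printed

open B11Eq115Space B9Eq33CovDerivVector
open B9SectCLatticeCarrier (Bond)

section Spelling

variable {d : ℕ} {Pd : Fin d → ℕ} {𝔸 : Type*} [Ring 𝔸] [Algebra ℂ 𝔸]

/-- **THE REFERENCE SPELLING of the derivative `∇ = ∇^{U₀}` of the size `|∇·|_{(−2)}` in (77)/(115)** at a background `U₀` with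
values in the units of the algebra `𝔸 ⊇ 𝔤ᶜ`: the componentwise covariant derivative (3.3) of [5],
`(∇A)((x,μ),ν) = η⁻¹(R(U₀(x,x+e_μ))A_ν(x+e_μ) − A_ν(x))`, `R(U)X = UXU⁻¹` (`B9Eq33CovDerivVector.covGrad`/`adTransport`), as a
COMPLEX-linear map with the scalar spelled `((η : ℂ))⁻¹`.  The space (115) is a type INDEXED BY THIS TERM (`Space115 L η lev₀ lev₁ ∇`),
so the letters (L2) `𝔊`, (L4) `H`, (L6) `H₁`, (L3) `W`, (L7), (L8) must be typed against ONE spelling to meet in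
`B11Eq115Space.chartHB115` without casts — this one (pub-balaban leaf-01 g63's precision P-ne9leaf01-g63-1: the spellings `(↑η)⁻¹`
and `↑(η⁻¹)` give EQUAL maps but not definitionally equal TYPES). [cite: Balaban1985BackgroundPropagators, (3.3) p.391] -/
abbrev nabla115 (η : ℝ) (U₀ : Bond d Pd → 𝔸ˣ) : (Bond d Pd → 𝔸) →ₗ[ℂ] (Bond d Pd × Fin d → 𝔸) :=
  covGrad ((η : ℂ)⁻¹) (adTransport U₀)

/-- Unfolding the reference spelling: `(∇A)((x,μ),ν) = η⁻¹·(U₀(b)·A_ν(b₊)·U₀(b)⁻¹ − A_ν(b₋))`, `b = (x, μ)` — (3.3) of [5] inside (115).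
[cite: Balaban1985BackgroundPropagators, (3.3) p.391] -/
theorem nabla115_apply (η : ℝ) (U₀ : Bond d Pd → 𝔸ˣ) (A : Bond d Pd → 𝔸) (b : Bond d Pd) (ν : Fin d) :
    nabla115 η U₀ A (b, ν) =
      ((η : ℂ))⁻¹ • ((U₀ b : 𝔸) * A (B9SectCLatticeCarrier.btgt b, ν) * ((U₀ b)⁻¹ : 𝔸ˣ) - A (B9SectCLatticeCarrier.bpos b, ν)) :=
  covGrad_adTransport_apply _ _ _ _ _

end Spelling

variable {d : ℕ} {Pd : Fin d → ℕ} {𝔸 : Type*} [NormedRing 𝔸] [NormedAlgebra ℂ 𝔸] [FiniteDimensional ℂ 𝔸]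
  {L η : ℝ} [Fact (0 < L)] [Fact (0 < η)] {lev₀ : Bond d Pd → ℕ}
  {F S : Type*} [AddCommGroup F] [Module ℂ F] [AddCommGroup S] [Module ℂ S]

/-- **INTERFACE REQUEST NE9 (L2): `𝔊` at the background `U₀`** — `frakGAt lev₁ U₀ G₁ Q Qadj Kinv D R Dstar :
NegSize L η lev₀ 3 𝔸 →L[ℂ] Space115 L η lev₀ lev₁ (nabla115 η U₀)` (= `… (covGrad ((η : ℂ)⁻¹) (adTransport U₀))` by `rfl`):
configurations `A₁` with values in the algebra `𝔸 ⊇ 𝔤ᶜ` on the positively oriented bonds of the periodic lattice, the derivative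
of the size `|∇·|_{(−2)}` being the covariant one of [5] (3.3) in the background `U₀`.
[cite: Balaban1985Variational, (111) p.294, (115) p.294, (117) p.295] -/
abbrev frakGAt (lev₁ : Bond d Pd × Fin d → ℕ) (U₀ : Bond d Pd → 𝔸ˣ) (G₁ : (Bond d Pd → 𝔸) →ₗ[ℂ] (Bond d Pd → 𝔸))
    (Q : (Bond d Pd → 𝔸) →ₗ[ℂ] F) (Qadj : F →ₗ[ℂ] (Bond d Pd → 𝔸)) (Kinv : F →ₗ[ℂ] F) (D : S →ₗ[ℂ] (Bond d Pd → 𝔸))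
    (R : S →ₗ[ℂ] S) (Dstar : (Bond d Pd → 𝔸) →ₗ[ℂ] S) :
    NegSize L η lev₀ 3 𝔸 →L[ℂ] Space115 L η lev₀ lev₁ (nabla115 η U₀) :=
  frakG lev₁ (nabla115 η U₀) G₁ Q Qadj Kinv D R Dstar

/-- The requested type, character for character as in the request line (with the complex scalar): `frakGAt` IS a
`NegSize L η lev₀ 3 𝔸 →L[ℂ] Space115 L η lev₀ lev₁ (covGrad ((η : ℂ)⁻¹) (adTransport U₀))` (definitional unfolding of `nabla115`).
[cite: Balaban1985Variational, (111) p.294] -/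
theorem frakGAt_eq (lev₁ : Bond d Pd × Fin d → ℕ) (U₀ : Bond d Pd → 𝔸ˣ) (G₁ : (Bond d Pd → 𝔸) →ₗ[ℂ] (Bond d Pd → 𝔸))
    (Q : (Bond d Pd → 𝔸) →ₗ[ℂ] F) (Qadj : F →ₗ[ℂ] (Bond d Pd → 𝔸)) (Kinv : F →ₗ[ℂ] F) (D : S →ₗ[ℂ] (Bond d Pd → 𝔸))
    (R : S →ₗ[ℂ] S) (Dstar : (Bond d Pd → 𝔸) →ₗ[ℂ] S) :
    (frakGAt lev₁ U₀ G₁ Q Qadj Kinv D R Dstar :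
        NegSize L η lev₀ 3 𝔸 →L[ℂ] Space115 L η lev₀ lev₁ (covGrad ((η : ℂ)⁻¹) (adTransport U₀))) =
      frakG lev₁ (covGrad ((η : ℂ)⁻¹) (adTransport U₀)) G₁ Q Qadj Kinv D R Dstar :=
  rfl

/-- At the printed letter the range property reads: `Q(𝔊f) = 0` and `RD*(𝔊f) = 0` for every current `f`, i.e. `𝔊f` lies in (102).
[cite: Balaban1985Variational, (110)–(111) p.294] -/
theorem frakGAt_mem_constraint102 (lev₁ : Bond d Pd × Fin d → ℕ) (U₀ : Bond d Pd → 𝔸ˣ)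
    {G₁ : (Bond d Pd → 𝔸) →ₗ[ℂ] (Bond d Pd → 𝔸)} {Q : (Bond d Pd → 𝔸) →ₗ[ℂ] F} {Qadj : F →ₗ[ℂ] (Bond d Pd → 𝔸)}
    {Kinv : F →ₗ[ℂ] F} {D : S →ₗ[ℂ] (Bond d Pd → 𝔸)} {R : S →ₗ[ℂ] S} {Dstar : (Bond d Pd → 𝔸) →ₗ[ℂ] S}
    (hK : ∀ y : F, Q (G₁ (Qadj (Kinv y))) = y) (h124 : ∀ s : S, Q (G₁ (D (R s))) = 0)
    (h124' : ∀ y : F, R (Dstar (G₁ (Qadj y))) = 0) (hRDR : ∀ s : S, R (Dstar (G₁ (D (R s)))) = R s)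
    (f : NegSize L η lev₀ 3 𝔸) :
    frakGAt lev₁ U₀ G₁ Q Qadj Kinv D R Dstar f ∈ constraint102 lev₁ (nabla115 η U₀) Q R Dstar :=
  frakG_mem_constraint102 _ _ hK h124 h124' hRDR f

end Printed

end Literature.MathematicalPhysics.QuantumFieldTheory.Balaban1983to89.B11Eq111FrakG
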